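import Summits.HodgeConjecture.HodgeCM.Model.Toy.ToyDimBump_1

/-! PORT of `HodgeCM/Model/Toy/ToyDimBump.lean` (HodgeCMPerL run 82) — part 2: continuation of `Summits.HodgeConjecture.HodgeCM.Model.Toy.ToyDimBump_1` (split at a top-level declaration boundary by port_pkg.py; scope re-opened below; declarations unchanged). -/

-- port_pkg: scope re-opened for this part (file-level context, then the namespace/section stack open at the cut)
noncomputable section
namespace HodgeCM
open Literature.AlgebraicGeometry.Motives (CMType HodgeStructure)
namespace Toy
open Universe
/-- (Ported verbatim from the HodgeCMPerL package; no docstring in the source.) -/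
theorem bumpModel_fact_fundClass : bumpModel.Fact_fundClass := WithDim.fact_fundClass_iff.mpr toyModel_fact_fundClass
/-- (Ported verbatim from the HodgeCMPerL package; no docstring in the source.) -/
theorem bumpModel_w_rk4 : bumpModel.W_RK4 := WithDim.w_RK4_iff.mpr toyModel_w_rk4
/-- (Ported verbatim from the HodgeCMPerL package; no docstring in the source.) -/
theorem bumpModel_pohlmannSpan : bumpModel.PohlmannSpan := WithDim.pohlmannSpan_iff.mpr toyModel_pohlmannSpan'
/-- (Ported verbatim from the HodgeCMPerL package; no docstring in the source.) -/
theorem bumpModel_qw8MilnePos : bumpModel.Qw8MilnePos := WithDim.qw8MilnePos toyModel_qw8MilnePos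
/-- (Ported verbatim from the HodgeCMPerL package; no docstring in the source.) -/
theorem bumpModel_cmProdH0Nontrivial : bumpModel.CMProdH0Nontrivial :=
  WithDim.cmProdH0Nontrivial_iff.mpr (cmProdH0Nontrivial exteriorHodgeData)
/-- (Ported verbatim from the HodgeCMPerL package; no docstring in the source.) -/
theorem bumpModel_hc_cm : bumpModel.HC_CM := WithDim.hc_cm_iff.mpr toyModel_hc_cm
/-- (Ported verbatim from the HodgeCMPerL package; no docstring in the source.) -/
theorem bumpModel_fact_factorActDescends : bumpModel.Fact_factorActDescends :=
  WithDim.fact_factorActDescends_iff.mpr (fact_factorActDescends exteriorHodgeData)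
/-- (Ported verbatim from the HodgeCMPerL package; no docstring in the source.) -/
theorem bumpModel_fact_cmInflation : bumpModel.Fact_cmInflation :=
  WithDim.fact_cmInflation_iff.mpr (fact_cmInflation exteriorHodgeData)
/-- (Ported verbatim from the HodgeCMPerL package; no docstring in the source.) -/
theorem bumpModel_fact_H0_rank : bumpModel.Fact_H0_rank := WithDim.fact_H0_rank_iff.mpr toyModel_fact_H0_rank

/-- **M40 FAILS in `bumpModel`**: `dim (pms × pms) = 5 ≠ 2 + 2`. -/
theorem not_bumpModel_fact_dimProd : ¬ bumpModel.Fact_dimProd :=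
  WithDim.not_fact_dimProd pmsObj pmsObj (by
    change dimBump (pmsObj.prod pmsObj) ≠ dimBump pmsObj + dimBump pmsObj
    rw [dimBump_pms2, dimBump_pmsObj]
    decide)

/-! ### Independence of M40 -/

/-- The statements both models satisfy: M1–M28, N1–N4 (M31–M34), F2 (M35), F4, F5 (M37), F7, F7d (M41), F7d-B, `Fact_unitH0`
(M43), N5 `Fact_fundClass`, `Fact_cmInflation` (M38), `Fact_H0_rank` (M42), `W_RK4`, `PohlmannSpan`, `Qw8MilnePos`,
`CMProdH0Nontrivial` and the conclusion `HC_CM` — every named input of FACTS §1c the exterior model satisfies, except M40. -/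
def DimContext (U : Universe) : Prop :=
  U.ModelAxioms ∧ U.Fact_cupExterior ∧ U.Fact_cup_hodge ∧ U.Fact_pull_H0 ∧ U.Fact_hodge_F0 ∧ U.Fact_factorActDescends ∧
    U.Fact_cupAlg ∧ U.Fact_cupAssoc ∧ U.Fact_gysin ∧ U.Fact_gysinDescent ∧ U.Fact_gysinDescentB ∧ U.Fact_unitH0 ∧
    U.Fact_fundClass ∧ U.Fact_cmInflation ∧ U.Fact_H0_rank ∧ U.W_RK4 ∧ U.PohlmannSpan ∧ U.Qw8MilnePos ∧
    U.CMProdH0Nontrivial ∧ U.HC_CM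

/-- (Ported verbatim from the HodgeCMPerL package; no docstring in the source.) -/
theorem toyModel_dimContext : DimContext toyModel :=
  ⟨toyModel_modelAxioms, toyModel_fact_cupExterior, toyModel_fact_cup_hodge, toyModel_fact_pull_H0, toyModel_fact_hodge_F0,
    fact_factorActDescends exteriorHodgeData, fact_cupAlg, fact_cupAssoc exteriorHodgeData, toyModel_fact_gysin,
    toyModel_fact_gysinDescent, toyModel_fact_gysinDescentB, toyModel_fact_unitH0, toyModel_fact_fundClass,
    fact_cmInflation exteriorHodgeData, toyModel_fact_H0_rank, toyModel_w_rk4, toyModel_pohlmannSpan', toyModel_qw8MilnePos,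
    cmProdH0Nontrivial exteriorHodgeData, toyModel_hc_cm⟩

/-- (Ported verbatim from the HodgeCMPerL package; no docstring in the source.) -/
theorem bumpModel_dimContext : DimContext bumpModel :=
  ⟨bumpModel_modelAxioms, bumpModel_fact_cupExterior, bumpModel_fact_cup_hodge, bumpModel_fact_pull_H0,
    bumpModel_fact_hodge_F0, bumpModel_fact_factorActDescends, bumpModel_fact_cupAlg, bumpModel_fact_cupAssoc,
    bumpModel_fact_gysin, bumpModel_fact_gysinDescent, bumpModel_fact_gysinDescentB, bumpModel_fact_unitH0,
    bumpModel_fact_fundClass, bumpModel_fact_cmInflation, bumpModel_fact_H0_rank, bumpModel_w_rk4, bumpModel_pohlmannSpan,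
    bumpModel_qw8MilnePos, bumpModel_cmProdH0Nontrivial, bumpModel_hc_cm⟩

/-- the two profiles side by side -/
theorem bumpModel_profile : DimContext bumpModel ∧ ¬ bumpModel.Fact_dimProd :=
  ⟨bumpModel_dimContext, not_bumpModel_fact_dimProd⟩

/-- (Ported verbatim from the HodgeCMPerL package; no docstring in the source.) -/
theorem toyModel_dimProfile : DimContext toyModel ∧ toyModel.Fact_dimProd :=
  ⟨toyModel_dimContext, toyModel_fact_dimProd⟩

/-- **M40 `Fact_dimProd` is INDEPENDENT of `ModelAxioms ∧ N1–N4 ∧ F2 ∧ F4 ∧ F5 ∧ F7 ∧ F7d ∧ F7d-B ∧ Fact_unitH0 ∧ N5 ∧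
Fact_cmInflation ∧ Fact_H0_rank ∧ W_RK4 ∧ PohlmannSpan ∧ Qw8MilnePos ∧ CMProdH0Nontrivial ∧ HC_CM`** (`toyModel`: true;
`bumpModel`: false). -/
theorem fact_dimProd_independent :
    (∃ U : Universe, DimContext U ∧ U.Fact_dimProd) ∧ (∃ U : Universe, DimContext U ∧ ¬ U.Fact_dimProd) :=
  ⟨⟨toyModel, toyModel_dimContext, toyModel_fact_dimProd⟩, ⟨bumpModel, bumpModel_dimContext, not_bumpModel_fact_dimProd⟩⟩

/-- Equivalently: M40 is not a consequence of the list. -/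
theorem not_fact_dimProd_of_dimContext : ¬ ∀ U : Universe, DimContext U → U.Fact_dimProd :=
  fun h => not_bumpModel_fact_dimProd (h bumpModel bumpModel_dimContext)

end Toy

/-! ### Addendum to `ToyCupScale`: the F5 separation in the same maximal context -/

namespace Universe.ScaleCup

variable {U : Universe}

set_option smartUnfolding false in
/-- (Ported verbatim from the HodgeCMPerL package; no docstring in the source.) -/
theorem fact_factorActDescends_iff : U.scaleCup.Fact_factorActDescends ↔ U.Fact_factorActDescends := Iff.rfl
/-- (Ported verbatim from the HodgeCMPerL package; no docstring in the source.) -/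
theorem fact_cmInflation_iff : U.scaleCup.Fact_cmInflation ↔ U.Fact_cmInflation := Iff.rfl
/-- (Ported verbatim from the HodgeCMPerL package; no docstring in the source.) -/
theorem fact_H0_rank_iff : U.scaleCup.Fact_H0_rank ↔ U.Fact_H0_rank := Iff.rfl

end Universe.ScaleCup

namespace Toy

open Universe

/-- (Ported verbatim from the HodgeCMPerL package; no docstring in the source.) -/
theorem cupModel_fact_factorActDescends : cupModel.Fact_factorActDescends :=
  ScaleCup.fact_factorActDescends_iff.mpr (fact_factorActDescends exteriorHodgeData)
/-- (Ported verbatim from the HodgeCMPerL package; no docstring in the source.) -/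
theorem cupModel_fact_cmInflation : cupModel.Fact_cmInflation :=
  ScaleCup.fact_cmInflation_iff.mpr (fact_cmInflation exteriorHodgeData)
/-- (Ported verbatim from the HodgeCMPerL package; no docstring in the source.) -/
theorem cupModel_fact_H0_rank : cupModel.Fact_H0_rank := ScaleCup.fact_H0_rank_iff.mpr toyModel_fact_H0_rank

/-- `CupContext` (ToyCupScale) enlarged by F2 (M35), M38, M42 and `HC_CM`: every named input of FACTS §1c the exterior model
satisfies, except F5. -/
def CupContextMax (U : Universe) : Prop :=
  CupContext U ∧ U.Fact_factorActDescends ∧ U.Fact_cmInflation ∧ U.Fact_H0_rank ∧ U.HC_CM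

/-- (Ported verbatim from the HodgeCMPerL package; no docstring in the source.) -/
theorem toyModel_cupContextMax : CupContextMax toyModel :=
  ⟨toyModel_cupContext, fact_factorActDescends exteriorHodgeData, fact_cmInflation exteriorHodgeData, toyModel_fact_H0_rank,
    toyModel_hc_cm⟩

/-- (Ported verbatim from the HodgeCMPerL package; no docstring in the source.) -/
theorem cupModel_cupContextMax : CupContextMax cupModel :=
  ⟨cupModel_cupContext, cupModel_fact_factorActDescends, cupModel_fact_cmInflation, cupModel_fact_H0_rank, cupModel_hc_cm⟩

/-- **F5 `Fact_cupAssoc` is INDEPENDENT of `ModelAxioms ∧ N1–N4 ∧ F2 ∧ F4 ∧ F7 ∧ F7d ∧ F7d-B ∧ Fact_unitH0 ∧ N5 ∧ Fact_dimProd ∧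
Fact_cmInflation ∧ Fact_H0_rank ∧ W_RK4 ∧ PohlmannSpan ∧ Qw8MilnePos ∧ CMProdH0Nontrivial ∧ HC_CM`** (`toyModel`: true;
`cupModel`: false) — the maximal-context form of `fact_cupAssoc_independent`. -/
theorem fact_cupAssoc_independent_max :
    (∃ U : Universe, CupContextMax U ∧ U.Fact_cupAssoc) ∧ (∃ U : Universe, CupContextMax U ∧ ¬ U.Fact_cupAssoc) :=
  ⟨⟨toyModel, toyModel_cupContextMax, fact_cupAssoc exteriorHodgeData⟩,
    ⟨cupModel, cupModel_cupContextMax, not_cupModel_fact_cupAssoc⟩⟩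

/-- (Ported verbatim from the HodgeCMPerL package; no docstring in the source.) -/
theorem not_fact_cupAssoc_of_cupContextMax : ¬ ∀ U : Universe, CupContextMax U → U.Fact_cupAssoc :=
  fun h => not_cupModel_fact_cupAssoc (h cupModel cupModel_cupContextMax)

end Toy

end HodgeCM

end

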